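import Summits.NavierStokesRegularity.JiaSverakCAP.Det2pdKernelCertLemmas
import Summits.NavierStokesRegularity.JiaSverakCAP.Det2pdKernelCertZm
import Summits.NavierStokesRegularity.JiaSverakCAP.Det2pdKernelCertZp
import HarnessLib

/-!
# The DET-2pd chain with its arithmetic hypotheses evaluated in the kernel (`JiaSverakCAP.Det2pdKernelCert`)

HONEST FRAMING (papers lane (c), PF-P2 writer seat papers-pfp2-w1 g3, for the audit cell `pub-nsjs`; companion of
`Det2pdChain`, `PreconditionedDetSign`, and of the data modules `Det2pdKernelCertZm` / `Det2pdKernelCertZp`). Finite-dimensional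
real linear algebra plus exact rational arithmetic; asserts nothing about Navier–Stokes and discharges none of the cell's
PAPER-LEVEL hypotheses (LEMMA C′(Ũ) / THEOREM CU: the window inverses and the coercivity inequality; LEMMA Y / Q1 / LM inside
the enclosure radius). What it does: of the binders of `Det2pdChain.exists_eigenvector_of_coercive_signCerts` — the kernel form
of the cell's verdict "DET-2pd ⇒ a real eigenvalue of `𝓛_Ũ|anti2` in `(z₋, z₊)`" — the ARITHMETIC ones are no longer hypotheses:
* `hS : 0 < det S′` (`S′ = diag s`, the 30 lift weights of record) — `det_S_pos`;
* `hsign : det Mt(z₋) · det Mt(z₊) < 0` — `hsign` below, from `Zm.det_MtR_pos` / `Zp.det_MtR_neg` (kernel: `P = Ui Li` with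
  triangular factors of known diagonal sign and `‖1 − P Mt'‖_F < 1`, whence `det (P Mt') > 0` by `PreconditionedDetSign`);
* test #2 `PosDefTest.hpos : Mt'ᵀ Mt' − η'² 1 ≻ 0` — `Zm.posDef` / `Zp.posDef` (kernel: `‖(Mt'ᵀ Mt' − η'² 1 − Rᵀ R) − μ 1‖_F < μ`);
* test #1 `SignTest.hθ, hπ, hκ` with `θ = 2^-50`, `π = √piSq`, `η = η'` — `Zm.signTest` / `Zp.signTest`;
* `hDL, hDR : 0 < det D` for the scaling `D = diag d` of record.
Here `Mt' = Mt(z±)` are the midpoint matrices `M̃_pd(z±)` of the cell's certificate of record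
(`cert/spectrum-g14/det2pd/det2pd_certB_v14.json`, sha256 `91cd8836…`) ROUNDED to the dyadic grid `2^-64`, and `η' = η_up + 2^-60`
(see the data modules). What REMAINS an input, exactly: the window-inverse data `R`, `hright`, `hleft` and the coercivity
`hδ`, `hcoer` (paper level), `a ≤ b`, and the two enclosures `hηa : ‖Mt(z₋) − D (S′⁻¹ − T(a)) D‖₂ ≤ η'(z₋)`,
`hηb : ‖Mt(z₊) − D (S′⁻¹ − T(b)) D‖₂ ≤ η'(z₊)` (certified interval arithmetic resting on THEOREM Y / LEMMA Q1 — class C over P;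
they follow from the record's `‖M̃_pd − D C̃ D‖₂ ≤ η ≤ η_up` and `‖Mt' − M̃_pd‖_F ≤ 2^-60`). The packaged statement is
`exists_eigenvector_of_kernelCerts`. References: the approximate-inverse / least-singular-value non-singularity tests, S. M. Rump,
*Verification methods*, Acta Numerica 19 (2010) §10 [Rump2010Verification]; everything is proved from first principles
[folklore].
-/

open scoped BigOperators Matrix Matrix.Norms.L2Operator
open Set

noncomputable section

namespace Summit.NavierStokesRegularity.JiaSverakCAP

namespace Det2pdKernelCert

open PreconditionedDetSign Det2pdChain

section Endpoints

/-! ### The two end points: real matrices and the kernel facts transported -/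

namespace Zm

/-- `Mt(z₋)` as a real matrix. [folklore] -/
def MtR : Matrix (Fin 30) (Fin 30) ℝ := Mt.map ((↑) : ℚ → ℝ)

/-- The preconditioner `P(z₋)` as a real matrix. [folklore] -/
def PR : Matrix (Fin 30) (Fin 30) ℝ := P.map ((↑) : ℚ → ℝ)

/-- The scaling `D = diag d` as a real matrix. [folklore] -/
def DR : Matrix (Fin 30) (Fin 30) ℝ := Matrix.diagonal fun i => (d i : ℝ)

/-- **Kernel-certified sign:** `0 < det Mt(z₋)`. [folklore] -/
theorem det_MtR_pos : 0 < MtR.det := by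
  have h : 0 < Mt.det :=
    det_pos_of_kernelFacts Mt Ui Li P Ui_mul_Li (frob_one_sub_P_mul_Mt.trans (by norm_num)) Ui_upper Li_lower Li_diag
      Ui_diag_prod_sign
  have hdet : MtR.det = ((Mt.det : ℚ) : ℝ) := by
    rw [MtR, ← Rat.coe_castHom, ← RingHom.mapMatrix_apply, ← RingHom.map_det]
  rw [hdet]
  exact_mod_cast h

/-- **Kernel-certified test #2:** `Mt(z₋)ᵀ Mt(z₋) − η'(z₋)² 1 ≻ 0`. [folklore] -/
theorem posDef : (MtRᵀ * MtR - (etaP : ℝ) ^ 2 • (1 : Matrix (Fin 30) (Fin 30) ℝ)).PosDef :=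
  posDef_of_kernelFacts Mt R etaP mu mu_pos frob_B_sub_mu

/-- `0 < det D`. [folklore] -/
theorem det_DR_pos : 0 < DR.det := det_diagonal_cast_pos d d_pos

/-- Test #1, `hθ`: `‖1 − P Mt(z₋)‖₂ ≤ 2^-50`. [folklore] -/
theorem norm_one_sub_PR_mul_MtR : ‖(1 : Matrix (Fin 30) (Fin 30) ℝ) - PR * MtR‖ ≤ ((1 / 2 ^ 50 : ℚ) : ℝ) :=
  norm_one_sub_P_mul_Mt_le P Mt (1 / 2 ^ 50) (by norm_num) (frob_one_sub_P_mul_Mt.le.trans (by norm_num))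

/-- Test #1, `hπ`: `‖P‖₂ ≤ √piSq`. [folklore] -/
theorem norm_PR_le : ‖PR‖ ≤ Real.sqrt piSq := norm_P_le P piSq frob_P_le

/-- Test #1, `hκ`: `2^-50 + √piSq · η' < 1`. [folklore] -/
theorem kappa_lt : ((1 / 2 ^ 50 : ℚ) : ℝ) + Real.sqrt piSq * (etaP : ℝ) < 1 := by
  have h := kappa_lt_one piSq etaP ((Finset.sum_nonneg fun i _ => Finset.sum_nonneg fun j _ => sq_nonneg _).trans
    frob_P_le) etaP_pos piSq_etaP_lt
  push_cast
  exact h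

/-- **Test #2 package at `z₋`:** every field kernel-certified except the enclosure `hη`. [folklore] -/
def posDefTest (C : Matrix (Fin 30) (Fin 30) ℝ) (hη : ‖MtR - DR * C * DR‖ ≤ (etaP : ℝ)) : PosDefTest C :=
  ⟨DR, DR, MtR, etaP, det_DR_pos, det_DR_pos, posDef, hη⟩

/-- **Test #1 package at `z₋`:** every field kernel-certified except the enclosure `hη`. [folklore] -/
def signTest (C : Matrix (Fin 30) (Fin 30) ℝ) (hη : ‖MtR - DR * C * DR‖ ≤ (etaP : ℝ)) : SignTest C where
  DL := DR
  DR := DR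
  Mt := MtR
  P := PR
  θ := ((1 / 2 ^ 50 : ℚ) : ℝ)
  π := Real.sqrt piSq
  η := etaP
  hDL := det_DR_pos
  hDR := det_DR_pos
  hθ := norm_one_sub_PR_mul_MtR
  hπ := norm_PR_le
  hη := hη
  hκ := kappa_lt

end Zm

namespace Zp

/-- `Mt(z₊)` as a real matrix. [folklore] -/
def MtR : Matrix (Fin 30) (Fin 30) ℝ := Mt.map ((↑) : ℚ → ℝ)

/-- The preconditioner `P(z₊)` as a real matrix. [folklore] -/
def PR : Matrix (Fin 30) (Fin 30) ℝ := P.map ((↑) : ℚ → ℝ)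

/-- The scaling `D = diag d` as a real matrix. [folklore] -/
def DR : Matrix (Fin 30) (Fin 30) ℝ := Matrix.diagonal fun i => (d i : ℝ)

/-- **Kernel-certified sign:** `det Mt(z₊) < 0`. [folklore] -/
theorem det_MtR_neg : MtR.det < 0 := by
  have h : Mt.det < 0 :=
    det_neg_of_kernelFacts Mt Ui Li P Ui_mul_Li (frob_one_sub_P_mul_Mt.trans (by norm_num)) Ui_upper Li_lower Li_diag
      Ui_diag_prod_sign
  have hdet : MtR.det = ((Mt.det : ℚ) : ℝ) := by
    rw [MtR, ← Rat.coe_castHom, ← RingHom.mapMatrix_apply, ← RingHom.map_det]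
  rw [hdet]
  exact_mod_cast h

/-- **Kernel-certified test #2:** `Mt(z₊)ᵀ Mt(z₊) − η'(z₊)² 1 ≻ 0`. [folklore] -/
theorem posDef : (MtRᵀ * MtR - (etaP : ℝ) ^ 2 • (1 : Matrix (Fin 30) (Fin 30) ℝ)).PosDef :=
  posDef_of_kernelFacts Mt R etaP mu mu_pos frob_B_sub_mu

/-- `0 < det D`. [folklore] -/
theorem det_DR_pos : 0 < DR.det := det_diagonal_cast_pos d d_pos

/-- Test #1, `hθ`: `‖1 − P Mt(z₊)‖₂ ≤ 2^-50`. [folklore] -/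
theorem norm_one_sub_PR_mul_MtR : ‖(1 : Matrix (Fin 30) (Fin 30) ℝ) - PR * MtR‖ ≤ ((1 / 2 ^ 50 : ℚ) : ℝ) :=
  norm_one_sub_P_mul_Mt_le P Mt (1 / 2 ^ 50) (by norm_num) (frob_one_sub_P_mul_Mt.le.trans (by norm_num))

/-- Test #1, `hπ`: `‖P‖₂ ≤ √piSq`. [folklore] -/
theorem norm_PR_le : ‖PR‖ ≤ Real.sqrt piSq := norm_P_le P piSq frob_P_le

/-- Test #1, `hκ`: `2^-50 + √piSq · η' < 1`. [folklore] -/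
theorem kappa_lt : ((1 / 2 ^ 50 : ℚ) : ℝ) + Real.sqrt piSq * (etaP : ℝ) < 1 := by
  have h := kappa_lt_one piSq etaP ((Finset.sum_nonneg fun i _ => Finset.sum_nonneg fun j _ => sq_nonneg _).trans
    frob_P_le) etaP_pos piSq_etaP_lt
  push_cast
  exact h

/-- **Test #2 package at `z₊`:** every field kernel-certified except the enclosure `hη`. [folklore] -/
def posDefTest (C : Matrix (Fin 30) (Fin 30) ℝ) (hη : ‖MtR - DR * C * DR‖ ≤ (etaP : ℝ)) : PosDefTest C :=
  ⟨DR, DR, MtR, etaP, det_DR_pos, det_DR_pos, posDef, hη⟩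

/-- **Test #1 package at `z₊`:** every field kernel-certified except the enclosure `hη`. [folklore] -/
def signTest (C : Matrix (Fin 30) (Fin 30) ℝ) (hη : ‖MtR - DR * C * DR‖ ≤ (etaP : ℝ)) : SignTest C where
  DL := DR
  DR := DR
  Mt := MtR
  P := PR
  θ := ((1 / 2 ^ 50 : ℚ) : ℝ)
  π := Real.sqrt piSq
  η := etaP
  hDL := det_DR_pos
  hDR := det_DR_pos
  hθ := norm_one_sub_PR_mul_MtR
  hπ := norm_PR_le
  hη := hη
  hκ := kappa_lt

end Zp

/-- **The sign change** `det Mt(z₋) · det Mt(z₊) < 0` — the binder `hsign` of the chain, kernel-certified. [folklore] -/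
theorem hsign : Zm.MtR.det * Zp.MtR.det < 0 := mul_neg_of_pos_of_neg Zm.det_MtR_pos Zp.det_MtR_neg

/-- The lift `S′ = diag s` of record (the same 30 weights at both end points). [folklore] -/
def SR : Matrix (Fin 30) (Fin 30) ℝ := Matrix.diagonal fun i => (Zm.s i : ℝ)

/-- The two data modules carry the same weights `s` (and `d`). [folklore] -/
theorem s_eq : Zp.s = Zm.s := by decide +kernel

/-- Idem for `d`. [folklore] -/
theorem d_eq : Zp.d = Zm.d := by decide +kernel

/-- `hS : 0 < det S′`, kernel-certified. [folklore] -/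
theorem det_SR_pos : 0 < SR.det := det_diagonal_cast_pos Zm.s Zm.s_pos

end Endpoints

section Chain

/-! ### The chain with kernel certificates plugged in -/

open scoped RealInnerProductSpace
open PencilEigenvalueWindow Literature.Analysis.OperatorTheory.WeinsteinAronszajnPencil

variable {V : Type*} [AddCommGroup V] [Module ℝ V]
variable {E : Type*} [NormedAddCommGroup E] [InnerProductSpace ℝ E]
variable {L J : V →ₗ[ℝ] E} {w : Fin 30 → E} {g : Fin 30 → E →L[ℝ] ℝ} {a b : ℝ}

/-- **DET-2pd ⇒ eigenvalue, with the arithmetic in the kernel.** Same statement as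
`Det2pdChain.exists_eigenvector_of_coercive_signCerts` for the lift `S′ = diag s` of record, with `hS`, both sign certificates
(test #2, `Zm.posDefTest` / `Zp.posDefTest`) and `hsign` supplied by this module. Remaining hypotheses, exactly: the two-sided
inverses `R z` of the modified pencil on `[a, b]` and ONE coercivity inequality at `b` (paper level: LEMMA C′(Ũ), THEOREM CU),
`a ≤ b`, and the two certified enclosures `hηa`, `hηb` of the W–A matrices `S′⁻¹ − T(a)`, `S′⁻¹ − T(b)` by the rounded midpoint
matrices of record in the scaled operator norm (class C over P). Conclusion: a non-zero `u` in the domain with `L u = z • J u` for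
some `z ∈ (a, b)`. [folklore] -/
theorem exists_eigenvector_of_kernelCerts (R : ℝ → (E →ₗ[ℝ] V))
    (hright : ∀ z ∈ Icc a b, ∀ x : E, pencilMod L J w (gLin g) SR z (R z x) = x)
    (hleft : ∀ z ∈ Icc a b, ∀ u : V, R z (pencilMod L J w (gLin g) SR z u) = u) {δ : ℝ} (hδ : 0 < δ)
    (hcoer : ∀ u : V, δ * ‖J u‖ ^ 2 ≤ ⟪pencilMod L J w (gLin g) SR b u, J u⟫) (hab : a ≤ b)
    (hηa : ‖Zm.MtR - Zm.DR * (SR⁻¹ - waMatrix J (R a) w (gLin g)) * Zm.DR‖ ≤ (Zm.etaP : ℝ))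
    (hηb : ‖Zp.MtR - Zp.DR * (SR⁻¹ - waMatrix J (R b) w (gLin g)) * Zp.DR‖ ≤ (Zp.etaP : ℝ)) :
    ∃ z ∈ Ioo a b, ∃ u : V, u ≠ 0 ∧ L u = z • J u :=
  exists_eigenvector_of_coercive_signCerts R hright hleft hδ hcoer hab det_SR_pos (Zm.posDefTest _ hηa).cert
    (Zp.posDefTest _ hηb).cert hsign

end Chain

end Det2pdKernelCert

end Summit.NavierStokesRegularity.JiaSverakCAP

end
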